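import Summits.AtomisticToContinuum.Crystallization.Theorems.CoarseGrains.Negative.PredicateAPI
import Summits.AtomisticToContinuum.Crystallization.Theorems.CoarseGrains.Negative.LoadBearing
import Summits.AtomisticToContinuum.Crystallization.Theorems.CoarseGrains.Negative.RadiusVacuity
import Summits.AtomisticToContinuum.Crystallization.Theorems.CoarseGrains.Negative.VacuityThreshold
import Summits.AtomisticToContinuum.Crystallization.Theorems.CoarseGrains.Negative.CoveringRadius
import Summits.AtomisticToContinuum.Crystallization.Theorems.CoarseGrains.Negative.CubicThreshold

/-!
# Disproof of `CoarseGrains` (crux stmt-AtomisticToContinuum-9331, route ExcessDecayLiouville) — findings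

Standing adversary file (cdisprove seats `refuter-cdisprove-stmt-AtomisticToContinuum-9331-0`, cycle 1,
and `…-9331-g2-0`, cycle 2; 2026-08-16).  VERDICT SO FAR: **no kill** — the crux is
crystallization-strength and resists every cheap attack.  What IS proved (kernel-checked, sorry-free,
standard axioms) has LANDED in the tree and is imported here rather than duplicated:
* `Theorems/CoarseGrains/Negative/PredicateAPI.lean` (p73332): the crux's predicates `Lam`/`Near`/`Adm`/
  `Inner` unbundled (`coarseGrains_iff` is `Iff.rfl`) + the Delone kit of admissible data;
* `Theorems/CoarseGrains/Negative/LoadBearing.lean` (p73741, commit 59fb5bcacaf0): minimality and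
  largeness are load-bearing, no `N₀` uniform in `R`;
* `Theorems/CoarseGrains/Negative/RadiusVacuity.lean` (p73942, commit e2bc5092ed77): `R < 97/200` is
  vacuous;
* CYCLE 2 (seat `refuter-cdisprove-stmt-AtomisticToContinuum-9331-g2-0`, 2026-08-16):
  `Theorems/CoarseGrains/Negative/VacuityThreshold.lean` (p75944): `R ≤ 7/10` is vacuous (octahedral hole
  of the maximally dilated datum `(199/200)·id`) and `Theorems/CoarseGrains/Negative/CoveringRadius.lean`
  (p75946): covering radius `≤ 4/5` for EVERY admissible datum, so the radius quantifier carries content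
  from `R ≥ 4/5` (`N₀(R) ≥ 1`; `N₀(R) > R − 9/5`) — the vacuity threshold is bracketed in `(0.70, 0.80)`;
  `Theorems/CoarseGrains/Negative/CubicThreshold.lean` (p76169): `N₀(R) ≥ ((R − 11/10)/4)³` — largeness
  is load-bearing at every scale; plus the cycle-2 read of the picked line's skeleton rev. 2 (seven
  stubs, §(d)) and the numerics job j010494 (§(d), "WHY" item 1).  VERDICT after cycle 2: still
  **no kill**.
Lines may `import` these modules directly (namespaces
`Summit.AtomisticToContinuum.Crystallization.Theorems.CoarseGrains.Negative.{PredicateAPI,LoadBearing,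
RadiusVacuity,VacuityThreshold,CoveringRadius,CubicThreshold}`); this file keeps the index, the
orientation lemmas and the prose of why the crux resists.

## The crux, read back (elaborates: `coarseGrains_iff` is `Iff.rfl`)

`CoarseGrains ↔ ∀ R > 0, ∃ N₀, ∀ N ≥ N₀, ∀ x : Fin N → ℝ³, IsGroundState V_LJ x →
  ∃ c t A, Adm A ∧ Inner t A ∧ Near (range x) c R t A (1/40)` with
* `Λ = ℤu + ℤv + ℤ·2√(2/3)e₃`, `u = (1,0,0)`, `v = (1/2,√3/2,0)` (`triangularVec₁/₂ 1`, `layerNormal`);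
* `Near X c r t A ε`: (i) every `p ∈ X` with `dist p c ≤ r` is within `ε` of SOME site `t m + A z`
  (`m : Fin 2`, `z ∈ Λ`; the site need not lie in the ball); (ii) every site with `dist (t m + A z) c ≤ r`
  has a particle within `ε`.  Closed balls, absolute tolerance `ε = 1/40`, `c` arbitrary (not a particle).
* `Adm A`: `‖A − 0.97·O‖_op ≤ 1/40` for some linear isometry `O` (reflections allowed);
  `Inner t A`: `‖t 1 − t 0 − A(w + √(2/3)e₃)‖ ≤ 1/40`, `w = barlowOffset 1 = (1/2, √3/6, 0)`.
* `IsGroundState` = injective ∧ energy `= E(N)` (infimum over injective configurations; genuine since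
  `V_LJ ≥ −1/12`); ground states exist for every `N` (`LennardJonesGroundStatesExist_holds`) and are
  `δ`-separated (`LennardJonesMinimalDistance_holds`), so the `∀ x` is neither vacuous nor junk-fed.
No junk operator occurs (`dist`, operator norm, `Real.sqrt` of positive literals only).  Quantifier order
matches the informal text (`N₀` depends on `R` only; the datum depends on the ground state).

## (a) Load-bearing hypotheses — any proof must use BOTH minimality and largeness
* `coarseGrains_false_without_minimality`: for arbitrary injective configurations the statement fails
  at `R = 3` (collinear gas spaced `10`: two adjacent sites of any admissible datum inside the ball need
  two distinct particles `≤ 21/20` apart).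
* `coarseGrains_false_without_largeness`: without `N ≥ N₀` it fails at `R = 2` (the empty ground state);
  quantitatively `succ_le_card_of_near` / `coarseGrains_threshold_lower_bound`: a matched `R`-ball needs
  `> R − 11/10` particles, so `N₀(R) > R − 21/10` in any proof.
* (`0 < R` is decoration: clause (ii) is the only content and it only gets weaker as `R` shrinks.)

## (b) Vacuity threshold in the radius — bracketed in `(0.70, 0.80)` (cycle 2)
The matrix holds for EVERY bounded `X` iff some admissible datum has a closed `R`-ball free of sites,
i.e. iff `R` is below the supremum of the covering radii of admissible site sets.
* cycle 1, `near_trivial_of_lt` / `coarseGrains_matrix_of_lt`: `R < 97/200` (datum `0.97·id` parked far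
  away, ball centred at a bond midpoint).
* cycle 2, `VacuityThreshold.near_trivial_of_le` / `coarseGrains_matrix_of_le`: `R ≤ 7/10` — datum
  `(199/200)·id` (admissible WITH EQUALITY `‖A − 0.97·id‖ = 1/40`), ball centred at the octahedral hole
  `c₀ = −w + ½√(2/3)e₃`, every site `≥ (199/200)/√2 ≈ 0.7036` away (integer quadratic forms
  `i² + ij + j² + i + j ≥ 0`, `i² + ij + j² + 2i + 2j + 1 ≥ 0` on `ℤ²`).  Provers may take `N₀ := 0` for
  `R ≤ 7/10`.
* cycle 2, `CoveringRadius.exists_site_near_two`: every point of `ℝ³` is within `4/5` of a site of ANY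
  admissible datum with `Inner` (two-sublattice rounding: error coordinates `≤ 1/2, √3/4, √(2/3)/2`,
  norm² `≤ 29/48`, times `199/200`, plus `1/40`); hence `not_near_empty` /
  `coarseGrains_matrix_fails_empty` / `one_le_threshold`: from `R ≥ 4/5` the matrix FAILS for the empty
  ground state (`N₀(R) ≥ 1`), and `succ_le_card_of_near_two` / `coarseGrains_threshold_lower_bound_two`:
  `N₀(R) > R − 9/5`.  The exact threshold (`≈ 0.70–0.72`: octahedral holes of dilated / `Inner`-shifted
  data) is needed by no line.  Genuine content (a particle with a complete `1/40`-hcp first shell) starts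
  at `R ≈ 1`; the true count of sites in a matched ball is `≈ 6.5·R³` (two sublattices of covolume
  `√2·det A`); formalised: `CubicThreshold.cube_le_card_of_near` / `coarseGrains_threshold_cubic` —
  a matched ball of radius `11/10 + 4K` holds the `(K+1)³` sites `t 0 + A(z₀ + iu + jv + kℓ)`,
  `0 ≤ i,j,k ≤ K`, so `N₀(R) ≥ ((R − 11/10)/4)³`.

## (c) Natural strengthenings refuted
* `not_coarseGrains_uniform`: `∃ N₀ ∀ R` (swap of the first two quantifiers) is FALSE — a ground state of
  `N₀` particles cannot fill a matched ball of radius `11/10 + N₀`.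
* NOT refutable here (each would need the structure of large ground states): tolerance `→ 0`; an exactly
  isotropic cell `A = 0.97·O` (the relaxed spacing is `a* ≈ 0.9713 ≠ 0.97`, so at tolerance `1/40` an
  isotropic `0.97` reference would fail for `R ≳ 20` IF the bulk is relaxed hcp — the affine window is
  what absorbs `a*`, `c/a ≈ 1.6328 ≠ √(8/3)` and the `O(R²N^{-2/3})` surface-stress strain); "a grain
  centred at every particle" (false at surface particles, unprovable without ground-state structure).
* cycle 2, mutations found NOT load-bearing (information for provers, proved as orientation lemmas below
  where cheap): `0 < R` is decoration (`coarseGrains_iff_forall_radius`: the matrix is antitone in `R`,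
  `near_mono_radius`), and provers may assume `R ≥ R₁` for any fixed `R₁` (`coarseGrains_of_large_radius`);
  the tolerance is monotone (`near_mono_tol`); reflections in `Adm` are not load-bearing (hcp is
  centrosymmetric: composing `A` with the rotation by `π` about `u` maps the two-lattice onto itself with
  `t₁ ↦ t₁ + A u`, so "proper `O` only" is conclusion-equivalent — not formalised); the potential enters
  erratically: for `V ≡ 0` every injective configuration is a ground state and the statement IS
  `CoarseGrainsWithoutMinimality` (refuted), for purely repulsive `V = r⁻¹²/12` no ground state with
  `N ≥ 2` exists (infimum `0` not attained) and it holds vacuously — any proof uses the attractive well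
  quantitatively (in the picked line: through `HcpBulkFloor` / `HcpDefectCoercivity`).
* cycle 2, strengthenings believed FALSE but unprovable here (recorded to save the next seat the time):
  tolerance `0` (exact affine-hcp balls: finite clusters carry inhomogeneous strain `~R²/L²`, so exact
  balls presumably never occur); `N₀(R)` polynomial in `R` (see "WHY", `N₀` is astronomically large for
  `R ≳ 2` layers); a datum common to ALL balls of one ground state (global `FineGrains`-type statements
  are the stronger siblings stmt-9330 / 0751, not this crux).

## (d) Targets — none handed over (payload `targets = []`, `stuck_stubs = []`); the picked line's stubs read for cheap falsity
Cycle 1 read skeleton rev. 1 (4 stubs; no stub-false).  CYCLE 2 read skeleton rev. 2 of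
`Lines/vanishing-excess-truss-rigidity.lean` (lead re-seated; 7 registered stubs + landed
`stub_trialBound`); verdict per stub (details in the seat's NOTES.md and in the evidence file
`numerics-cycle2.md` on the item: hub-side pure-Python float runs, parts A–D, CONFIRMED with larger
cutoffs by the numpy compute job j010494 — ball radius 40, in-plane cutoff 36, all 38 h/c classes of
ABC period `≤ 10`; its stdout is attached to the item by the gate):
* `stub_hcpEnergySeries` (M) — TRUE modulo `energyPerParticle` bookkeeping: `‖iu + jv + w‖² =
  i² + ij + j² + i + j + 1/3` checked; all odd layers of hcp sit at in-plane offset `+w`; both motif points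
  have the same site sum (`P − b = −P`); the `v = 0` term is the only self-term.  Part C: the
  `Q`-series minimiser `(c₀, a, h, e) = (0.816382, 0.971274, 0.792930, −0.7175892)` coincides with an
  independent layer-sum relaxation of hcp to `4·10⁻⁷` in `e` — the index formula is cross-validated.
* `stub_pinNumerics` (L, computation) — NUMERICALLY CONSISTENT (part A: `S₃,S₆,D₃,D₆` of `hcp(1,c)`,
  ball radius 26 + continuum tails, `c`-step `0.0025`): the stationarity defect `F = S₆D₃ − S₃D₆` has
  exactly ONE sign change on `[0.78, 0.85]`, at `c₀ = 0.816382`; there `a = (S₆/S₃)^{1/6} = 0.971274`,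
  `h/√(2/3) = (27/8·c₀⁶·S₆/S₃)^{1/6} = 0.971137` (`h = 0.792930`) — inside `[0.945, 0.995]` with margins
  `0.0263/0.0237` and `0.0261/0.0239`; `argmax S₃²/S₆ = c₀`; the lead's sign claims for `γ` are
  reproduced (`+0.464 … +0.146` on `[0.78, 0.805]`, `−0.141 … −0.417` on `[0.8275, 0.85]`); the dilation
  identity alone gives `a(c) ∈ [0.9628, 0.9829]`, `h/√(2/3) ∈ [0.9510, 0.9905]` on `[0.79, 0.84]`, and on
  the whole box `a(c)` is strictly DECREASING, `h/√(2/3)` strictly INCREASING in `c`.  TWO STRUCTURAL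
  REMARKS for the lead: (1) the stub's two hypotheses are REDUNDANT — each alone pins `c` near `c₀`:
  stationarity through the transversal sign change of `F`, shape maximality because
  `e_min(c) = −S₃²/(24S₆)` rises from `−0.717589` at `c₀` to `−0.714395` at `0.79` and `−0.715061` at
  `0.84` (gaps `≥ 2.5·10⁻³ ≫` the `~10⁻⁴` tail/certification error); so the certificate may use whichever
  is cheaper, and if Stub B is RESHAPED to drop the stationarity antecedent (maximality only: certified
  upper bounds for `S₃²/S₆` on `[0.78, 0.79] ∪ [0.84, 0.85]` below a certified lower bound at one
  rational point near `c₀`, then the monotone sixth powers at the two ends of `[0.79, 0.84]` — still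
  true with the margins above), `stub_pinFromSeries` no longer needs the Fermat-in-`h` step, i.e. NO
  termwise differentiation of the `tsum` — its only delicate analytic input disappears (the dilation
  step is algebra on two summable series).  (2) Either way the proof must ENCLOSE the pinned
  set first and bound the two sixth powers on the enclosure; by the monotonicity just recorded that costs
  two certified evaluations each — evaluating at grid points alone is not a proof.
* `stub_pinFromSeries` (L) — TRUE: dilation parabola ⇒ `a⁶ = S₆/S₃`, `e = −S₃²/(24S₆)`; Fermat in `h`
  with `S_n' = −2nc·D_n` ⇒ `S₆D₃ = S₃D₆`; comparison with the optimally dilated `hcp(·, ·c')` ⇒ the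
  maximality hypothesis.  Only analytic input: termwise differentiation of the `tsum` in `h` (dominated on
  a neighbourhood by the sixth-power series).
* `stub_keyRigidity` (M) — TRUE on the whole box, and the proof sketch needs only the "into" half of its
  hypothesis: `n ∈ L ⇔ 2n ∈ P` for `n ∈ P` since `2w = (2/3)(u + v) ∉ ℤu + ℤv`; vectors of `L` of norm
  `≤ a` are in-plane because `2h ≥ 1.56a > a`; two minimal vectors of the triangular lattice at `60°`
  generate it; `‖b‖² = a²/3 + h² ≤ 1.06 < (5/4)²`; `‖2u‖ = 2a ≤ 5/2`.  Part D: the full isometry group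
  of the centred radius-`5/2` cluster of `hcp(a, ca)` at the 18 box points `a ∈ {0.94, 0.97, 1}`,
  `c ∈ {0.78, 0.80, √(2/3), 0.81638, 0.83, 0.85}` (cluster sizes 86–134) has order `12` everywhere
  (`6` proper + `6` improper = `D_{3h}`, the site group), and every element maps `hcp ∩ B₆` into hcp —
  also at the ideal ratio where the two first shells merge.
* `stub_exactLocalRules` (L) — TRUE: `B̄_{5/2}(x') ⊆ B°₄(Aq)` as `‖q' − q‖ ≤ 1.03 < 3/2`; `P − q' = ±P`;
  decreasing-norm neighbour paths exist because `h² > a²/3` on the box (`h ≥ 0.78a`).  Context: the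
  general regularity radius of Delone sets in `ℝ³` satisfies `6R ≤ ρ̂₃ ≤ 10R` (`R` = covering radius;
  Baburin–Bouniaev–Dolbilin–Erokhovets–Garber–Krivovichev–Schulte 2018, doi:10.1107/s2053273318012135,
  Thm "2dR"), and `4 ≈ 5.8·R_cov(hcp)` is BELOW `6R` — no contradiction: the `6R` worst case is attained
  by elongated "Engel sets", whereas for hcp the centred `5/2`-cluster (`≈ 3.6 R_cov`) is already rigid
  (Stub D) and the hypothesis here fixes the cluster CLASS (the hcp one), which is all the propagation
  uses.
* `stub_compactness` (L) — TRUE (contradiction + compactness; `θ` may depend on `δ`, as it must).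
  Simplification hint: the sets `F_n` have uniformly bounded cardinality, so labelled subsequences of
  finitely many points converge — no `NonemptyCompacts`/Hausdorff API is needed; closed radius-`4`
  matching in `Good` passes to the limit as the closed clause of Stub E's rule, particle-side matching as
  its open clause (`dist < 4`), exactly as Stub E is stated.
* `stub_isoDictionary` (M) — TRUE (cycle 1; triage-1's `IsoIsAdmissible.lean` proved the `Adm` part).
No `stub-false` / `stub-misstated` finding; no evidence note filed beyond this file and the job summary.

## WHY THE CRUX RESISTS (for ideators / the lead)
`¬CoarseGrains ⟺ ∃ R, for infinitely many N some LJ ground state has no two-way (1/40)-matched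
admissible hcp ball of radius R`.  Exhibiting this needs STRUCTURAL knowledge of large Lennard-Jones
ground states in `ℝ³` for infinitely many `N` — the crystallization problem itself (BlancLewin2015 §2.3,
"completely open in dimension three").  The rigorous facts in hand (existence, `δ`-separation,
`E(N) ≥ −CN`, neighbour counting, the `N = 13` icosahedral comparison of
`Literature.Barriers.AtomisticToContinuum.IcosahedralClusters`) constrain nothing at scale `R` for large
`N`.  Kill routes tried and why each dies:
1. *fcc / polytype bulk* (the route's own kill criterion).  Numerically hcp beats fcc by `7.2·10⁻⁵` per
   particle (A₆/A₁₂ lattice sums, Stillinger2001; planners' jobs j007505/j007600) and the registry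
   couplings `g_n = f_n^same − f_n^diff` between layers `n` apart decay geometrically, so
   `|g_2| ≫ Σ_{n≥3} n|g_n|` ("Hägg domination", tree items 0716/0737) makes hcp optimal among ALL Barlow
   stackings.  Hub-side sanity evaluation at the relaxed cell `(a, h) = (0.9713, 0.7930)` (direct layer
   sums, in-plane cutoff 20 + continuum tails): `g_2 = −7.26·10⁻⁵` (aligned second-neighbour layers win ⇒
   every layer wants h-character ⇒ ABAB), `|g_3| ≈ 6·10⁻⁸` and `|g_{n≥4}|` below the `~3·10⁻⁸` cutoff
   floor, so one c-type layer costs `≈ 7·10⁻⁵` per atom of that layer against `< 10⁻⁶` of possible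
   longer-range gain; per particle `e_hcp = −0.717592`, `e_fcc − e_hcp = +7.25·10⁻⁵`,
   `e_dhcp − e_hcp = +3.63·10⁻⁵` (half the layers c-type).  The cycle-1 scan job j007969 never ran
   (farm congestion); CYCLE 2 ran the scan hub-side (part B of `numerics-cycle2.md`; numpy version =
   job j010494): relaxed hcp `(a, h, e) = (0.971274, 0.792930, −0.71758878)`, couplings
   `g_2 = −7.263·10⁻⁵`, `g_3 = −4.2·10⁻⁸`, `|g_{4..8}| ≈ 4·10⁻⁸` (tail floor); ALL 61 h/c necklaces of
   period `≤ 8` containing a c-layer (every Barlow stacking type of Zhdanov period `≤ 8`), each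
   RE-RELAXED in `(a, h)`, lie above hcp — minimum `+9.0·10⁻⁶` per particle (`chhhhhhh`) — by a
   context-independent `7.20–7.25·10⁻⁵` PER c-LAYER ATOM (fcc `+7.244·10⁻⁵`, dhcp `+3.625·10⁻⁵`, …),
   with re-relaxation gains `≤ 6.2·10⁻⁸`; job j010494 (cutoff 36, 36 layers, all 38 h/c classes of ABC
   period `≤ 10`) sharpens the per-c-layer cost to `7.253–7.266·10⁻⁵` and resolves `g_3 = −8.49·10⁻⁸`,
   `g_{4..12} ∈ [−2.2, −0.9]·10⁻¹⁰`: Hägg domination is numerically robust and relaxation-proof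
   (ideator-2's independent floats: `J₂ = −7.27·10⁻⁵`, `J₃ = −8.5·10⁻⁸`).  Even a
   hypothetical better phase `P*` would not
   refute the crux in Lean: the cut-and-paste argument needs a LOWER bound `≥ e_hcp − o(1)` per particle
   on the energy of `1/40`-near-hcp balls, unavailable because `1/40` is far outside the perturbative
   radius (`|V‴/V″| = 21` at the bond length ⇒ radius `~1/400`).
2. *amorphous / icosahedral bulk* (barriers IcosahedralClusters, TetrahedralFrustration): finite-`N`
   numerics (Mackay icosahedra to `N ~ 10³`, Marks decahedra to `~10⁵`, close packing beyond; Doye–Calvo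
   2002) point the other way asymptotically, and no theorem-level handle exists in either direction; the
   barrier's proved content (`N = 13` crystal shells are not ground states) only says `N₀(1.05) ≥ 14`.
3. *surface-stress strain gradients*: mismatch `O(R²·N^{-2/3})` on a ball of radius `R` after the affine
   fit — absorbed by `N₀(R)`; uniform strain and the non-ideal `c/a` are absorbed by the affine window,
   and `Inner` holds EXACTLY for relaxed hcp (Wyckoff position 2c of P6₃/mmc is symmetry-fixed).
4. *vacancies / faults in the bulk*: positive formation energy and no entropy at `T = 0`; pigeonhole over
   `N/(CR³)` disjoint balls vs `O(N^{2/3})`-type defect budgets gives a clean ball — no mechanism for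
   "a defect in EVERY `R`-ball of EVERY large ground state" is known, none is provable.
5. *degenerate parameters*: `N = 0,…,4` ground states (unit simplices, provable) are locally
   hcp-embeddable and only re-prove that `N₀` is needed; `R → 0` is vacuous (b); `R → ∞` with `N` fixed
   is (c).
6. *negatives index* (12 entries): 3506 (piling on one site — excluded: ground states are injective and
   the sites are `≥ 7/10`-separated, `site_eq_of_dist_lt`) and 4146 (decahedral soft shell at 1 % — a
   statement about contact-graph rigidity, not about ground states) are not instances.
7. *cycle 2 — how large `N₀` must be.*  The hcp-vs-fcc bulk preference is `7.25·10⁻⁵` per particle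
   while twin-boundary / stacking-fault / facet-energy differences are `O(1)·N^{2/3}`; so exact ground
   states may stay fcc-rich or multiply twinned up to `N ~ (ΔΓ/7.25·10⁻⁵)³ ~ 10⁹–10¹²`, and an fcc ball of
   radius `≳ 2` layers is `≈ 0.28`-far (two-way) from every admissible hcp datum (informal statement;
   first-shell obstruction: the three "eclipsed" pairs of the anticuboctahedron have equal difference
   vectors of length `2h ∈ [1.54, 1.63]` after `A`, the cuboctahedron offers only `√2s ≈ 1.37` and
   `√3s ≈ 1.68`, margin `≈ 0.007 > 0` at `s = 0.971` with tolerance `1/20` on differences).  Hence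
   `N₀(R)` is astronomically large for `R ≳ 2`: only soft (`N → ∞`, compactness / averaging) proofs can
   work, and NO finite computation can refute the crux either — both sides are blocked by the same wall.
Barrier verdict: IcosahedralClusters / TetrahedralFrustration bite this crux exactly as catalogued (it is
the route's declared bet); KissingTwelveDegeneracy / ShortRangeStackingBlindness / HcpNotBravais are
respected by the statement's shape (two sublattices, full-tail energetics upstream).  Nothing catalogued
yields a counterexample.

## HANDOFF for re-arm
Landed under `Theorems/CoarseGrains/Negative/`: PredicateAPI (p73332), LoadBearing (p73741), RadiusVacuity
(p73942) [cycle 1]; VacuityThreshold (p75944), CoveringRadius (p75946), CubicThreshold (p76169) [cycle 2].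
Sorried here: nothing.
Numerics: `numerics-cycle2.md` on the item (cycle 2; parts A–D as in §(d) and "WHY" 1; confirmed by
the numpy job j010494, §E of that file).  Next regimes if re-armed with targets: the
lead's stuck stubs (rev. 2 names: `stub_pinNumerics` enclosure of `c₀`, `stub_exactLocalRules` rim
bookkeeping, `stub_compactness` limit extraction); a certified version of the `N = 13` remark; if a
planner ever restates the crux with tolerance `ε → 0` or particle-centred balls, §(c) lists what becomes
attackable.
-/


noncomputable section

open Literature.MathematicalPhysics.StatisticalMechanics
open Summit.AtomisticToContinuum.Crystallization.Theorems.CoarseGrains.Negative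
open Summit.AtomisticToContinuum.Crystallization.Theorems.CoarseGrains.Negative.PredicateAPI
open Summit.AtomisticToContinuum.Crystallization.Theorems.CoarseGrains.Negative.LoadBearing
open Summit.AtomisticToContinuum.Crystallization.Theorems.CoarseGrains.Negative.VacuityThreshold
open Summit.AtomisticToContinuum.Crystallization.Theorems.CoarseGrains.Negative.CoveringRadius
open Summit.AtomisticToContinuum.Crystallization.Theorems.CoarseGrains.Negative.CubicThreshold

namespace Summit.AtomisticToContinuum.Crystallization.Cruxes.CoarseGrains.Disproof

/-! ## Index of the landed negative knowledge (aliases; statements displayed for the reader) -/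

/-- (a) Minimality is load-bearing: the crux with `IsGroundState` weakened to `Injective` is false
(collinear gas, `R = 3`).  Landed: `Negative.LoadBearing`. [folklore] -/
theorem coarseGrains_false_without_minimality : ¬ CoarseGrainsWithoutMinimality :=
  LoadBearing.coarseGrains_false_without_minimality

/-- (a) Largeness is load-bearing: the crux without `N ≥ N₀` is false (empty ground state, `R = 2`).
Landed: `Negative.LoadBearing`. [folklore] -/
theorem coarseGrains_false_without_largeness : ¬ CoarseGrainsWithoutLargeness :=
  LoadBearing.coarseGrains_false_without_largeness

/-- (a, quantitative) any threshold `N₀` valid at radius `R` exceeds `R − 11/10 − 1`. [folklore] -/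
theorem coarseGrains_threshold_lower_bound {R : ℝ} {N₀ : ℕ}
    (h : ∀ N : ℕ, N₀ ≤ N → ∀ x : Fin N → E3, IsGroundState lennardJones x →
      ∃ (c : E3) (t : Fin 2 → E3) (A : E3 →L[ℝ] E3), Adm A ∧ Inner t A ∧
        Near (Set.range x) c R t A (1 / 40)) :
    R - 11 / 10 < N₀ :=
  LoadBearing.coarseGrains_threshold_lower_bound h

/-- (b) Radius vacuity: for `R < 97/200` the matrix of the crux holds for every finite configuration.
Landed: `Negative.RadiusVacuity`. [folklore] -/
theorem coarseGrains_matrix_of_lt {R : ℝ} (hR : R < 97 / 200) {N : ℕ} (x : Fin N → E3) :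
    ∃ (c : E3) (t : Fin 2 → E3) (A : E3 →L[ℝ] E3), Adm A ∧ Inner t A ∧
      Near (Set.range x) c R t A (1 / 40) :=
  RadiusVacuity.coarseGrains_matrix_of_lt hR x

/-- (c) The quantifier swap `∃ N₀ ∀ R` is false.  Landed: `Negative.LoadBearing`. [folklore] -/
theorem not_coarseGrains_uniform :
    ¬ ∃ N₀ : ℕ, ∀ R : ℝ, 0 < R → ∀ N : ℕ, N₀ ≤ N → ∀ x : Fin N → E3,
      IsGroundState lennardJones x →
      ∃ (c : E3) (t : Fin 2 → E3) (A : E3 →L[ℝ] E3), Adm A ∧ Inner t A ∧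
        Near (Set.range x) c R t A (1 / 40) :=
  LoadBearing.not_coarseGrains_uniform

/-! ### Cycle 2 additions to the index -/

/-- (b, cycle 2) Radius vacuity up to `7/10`: the matrix holds for every finite configuration
(octahedral hole of the datum `(199/200)·id`).  Landed: `Negative.VacuityThreshold`. [folklore] -/
theorem coarseGrains_matrix_of_le {R : ℝ} (hR : R ≤ 7 / 10) {N : ℕ} (x : Fin N → E3) :
    ∃ (c : E3) (t : Fin 2 → E3) (A : E3 →L[ℝ] E3), Adm A ∧ Inner t A ∧
      Near (Set.range x) c R t A (1 / 40) :=
  VacuityThreshold.coarseGrains_matrix_of_le hR x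

/-- (b, cycle 2) Covering radius `≤ 4/5` of the site set of every admissible datum with `Inner`.
Landed: `Negative.CoveringRadius`. [folklore] -/
theorem exists_site_near_two {A : E3 →L[ℝ] E3} (hA : Adm A) {t : Fin 2 → E3} (ht : Inner t A)
    (c : E3) : ∃ m : Fin 2, ∃ z ∈ Lam, dist (t m + A z) c ≤ 4 / 5 :=
  CoveringRadius.exists_site_near_two hA ht c

/-- (b, cycle 2) From `R ≥ 4/5` the matrix fails for the empty ground state: `N₀(R) ≥ 1`.
Landed: `Negative.CoveringRadius`. [folklore] -/
theorem coarseGrains_matrix_fails_empty {R : ℝ} (hR : 4 / 5 ≤ R) (x : Fin 0 → E3) :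
    ¬ ∃ (c : E3) (t : Fin 2 → E3) (A : E3 →L[ℝ] E3), Adm A ∧ Inner t A ∧
      Near (Set.range x) c R t A (1 / 40) :=
  CoveringRadius.coarseGrains_matrix_fails_empty hR x

/-- (a/b, cycle 2) Any threshold valid at radius `R` exceeds `R − 9/5`.  Landed:
`Negative.CoveringRadius`. [folklore] -/
theorem coarseGrains_threshold_lower_bound_two {R : ℝ} {N₀ : ℕ}
    (h : ∀ N : ℕ, N₀ ≤ N → ∀ x : Fin N → E3, IsGroundState lennardJones x →
      ∃ (c : E3) (t : Fin 2 → E3) (A : E3 →L[ℝ] E3), Adm A ∧ Inner t A ∧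
        Near (Set.range x) c R t A (1 / 40)) :
    R - 4 / 5 < N₀ :=
  CoveringRadius.coarseGrains_threshold_lower_bound_two h

/-- (a, cycle 2) Largeness is load-bearing at every scale: `N₀(R) ≥ ((R − 11/10)/4)³`.  Landed:
`Negative.CubicThreshold`. [folklore] -/
theorem coarseGrains_threshold_cubic {R : ℝ} {N₀ : ℕ}
    (h : ∀ N : ℕ, N₀ ≤ N → ∀ x : Fin N → E3, IsGroundState lennardJones x →
      ∃ (c : E3) (t : Fin 2 → E3) (A : E3 →L[ℝ] E3), Adm A ∧ Inner t A ∧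
        Near (Set.range x) c R t A (1 / 40))
    (K : ℕ) (hR : 11 / 10 + 4 * K ≤ R) : (K + 1) ^ 3 ≤ N₀ :=
  CubicThreshold.coarseGrains_threshold_cubic h K hR

/-! ## Orientation: the `Without` variants are weakenings of the crux's hypotheses

(These two conclude the Theses decl CONDITIONALLY and therefore live only in this work file, not under
`Theorems/`.) -/

/-- `CoarseGrainsWithoutLargeness → CoarseGrains` (take `N₀ := 0`). [folklore] -/
theorem coarseGrains_of_withoutLargeness :
    CoarseGrainsWithoutLargeness → Theses.ExcessDecayLiouville.CoarseGrains :=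
  fun h R hR => ⟨0, fun N _ x hx => h R hR N x hx⟩

/-- `CoarseGrainsWithoutMinimality → CoarseGrains` (ground states are injective). [folklore] -/
theorem coarseGrains_of_withoutMinimality :
    CoarseGrainsWithoutMinimality → Theses.ExcessDecayLiouville.CoarseGrains :=
  fun h R hR => by
    obtain ⟨N₀, hN₀⟩ := h R hR
    exact ⟨N₀, fun N hN x hx => hN₀ N hN x hx.1⟩

/-! ### Cycle 2 orientation lemmas: `0 < R` is decoration, the matrix is antitone in `R` and monotone
in the tolerance, and provers may assume `R ≥ R₁` for any fixed `R₁` -/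

/-- The two-way matching is antitone in the radius. [folklore] -/
theorem near_mono_radius {X : Set E3} {c : E3} {r r' : ℝ} {t : Fin 2 → E3} {A : E3 →L[ℝ] E3} {ε : ℝ}
    (h : r' ≤ r) (hN : Near X c r t A ε) : Near X c r' t A ε :=
  ⟨fun p hp hpc => hN.1 p hp (hpc.trans h), fun m z hz hzc => hN.2 m z hz (hzc.trans h)⟩

/-- The two-way matching is monotone in the tolerance. [folklore] -/
theorem near_mono_tol {X : Set E3} {c : E3} {r : ℝ} {t : Fin 2 → E3} {A : E3 →L[ℝ] E3} {ε ε' : ℝ}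
    (h : ε ≤ ε') (hN : Near X c r t A ε) : Near X c r t A ε' :=
  ⟨fun p hp hpc => by
    obtain ⟨m, z, hz, hd⟩ := hN.1 p hp hpc
    exact ⟨m, z, hz, hd.trans h⟩,
   fun m z hz hzc => by
    obtain ⟨p, hp, hd⟩ := hN.2 m z hz hzc
    exact ⟨p, hp, hd.trans h⟩⟩

/-- **Provers may assume `R ≥ R₁`** for any fixed `R₁`: the crux follows from its instances at large
radii (restrict the matched ball). [folklore] -/
theorem coarseGrains_of_large_radius (R₁ : ℝ)
    (h : ∀ R : ℝ, R₁ ≤ R → ∃ N₀ : ℕ, ∀ N : ℕ, N₀ ≤ N → ∀ x : Fin N → E3,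
      IsGroundState lennardJones x →
      ∃ (c : E3) (t : Fin 2 → E3) (A : E3 →L[ℝ] E3), Adm A ∧ Inner t A ∧
        Near (Set.range x) c R t A (1 / 40)) :
    Theses.ExcessDecayLiouville.CoarseGrains := by
  rw [PredicateAPI.coarseGrains_iff]
  intro R _
  obtain ⟨N₀, hN₀⟩ := h (max R R₁) (le_max_right _ _)
  refine ⟨N₀, fun N hN x hx => ?_⟩
  obtain ⟨c, t, A, hA, ht, hNear⟩ := hN₀ N hN x hx
  exact ⟨c, t, A, hA, ht, near_mono_radius (le_max_left _ _) hNear⟩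

/-- **`0 < R` is decoration:** the crux is equivalent to its `∀ R` form without the positivity guard.
[folklore] -/
theorem coarseGrains_iff_forall_radius :
    Theses.ExcessDecayLiouville.CoarseGrains ↔
    ∀ R : ℝ, ∃ N₀ : ℕ, ∀ N : ℕ, N₀ ≤ N → ∀ x : Fin N → E3,
      IsGroundState lennardJones x →
      ∃ (c : E3) (t : Fin 2 → E3) (A : E3 →L[ℝ] E3), Adm A ∧ Inner t A ∧
        Near (Set.range x) c R t A (1 / 40) := by
  constructor
  · intro h R
    rw [PredicateAPI.coarseGrains_iff] at h
    obtain ⟨N₀, hN₀⟩ := h (max R 1) (lt_of_lt_of_le one_pos (le_max_right _ _))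
    refine ⟨N₀, fun N hN x hx => ?_⟩
    obtain ⟨c, t, A, hA, ht, hNear⟩ := hN₀ N hN x hx
    exact ⟨c, t, A, hA, ht, near_mono_radius (le_max_left _ _) hNear⟩
  · intro h
    exact coarseGrains_of_large_radius 0 fun R _ => h R

/-- **The small-radius regime is settled outright:** for `R ≤ 7/10` the threshold `N₀ := 0` works
(cycle 2, (b)); combined with `coarseGrains_of_large_radius`, any proof may start at `R ≥ 4/5`, where
`N₀ ≥ 1` is forced (`coarseGrains_matrix_fails_empty`). [folklore] -/
theorem coarseGrains_threshold_zero_of_le {R : ℝ} (hR : R ≤ 7 / 10) :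
    ∀ N : ℕ, 0 ≤ N → ∀ x : Fin N → E3, IsGroundState lennardJones x →
      ∃ (c : E3) (t : Fin 2 → E3) (A : E3 →L[ℝ] E3), Adm A ∧ Inner t A ∧
        Near (Set.range x) c R t A (1 / 40) :=
  fun _ _ x _ => coarseGrains_matrix_of_le hR x

/-! ## (d) Targets — none handed over (payload `targets = []`); the rev-2 stubs were read for cheap
falsity (docblock §(d)): no stub-false.  (e) Near-misses — none: no candidate kill of the crux is
believed true by this seat (see "WHY THE CRUX RESISTS" above). -/

/-- Probe: the crux elaborates; this `example`-style restatement is what a kill would have to negate. -/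
theorem crux_unfolded_iff :
    Theses.ExcessDecayLiouville.CoarseGrains ↔
    ∀ R : ℝ, 0 < R → ∃ N₀ : ℕ, ∀ N : ℕ, N₀ ≤ N → ∀ x : Fin N → E3,
      IsGroundState lennardJones x →
      ∃ (c : E3) (t : Fin 2 → E3) (A : E3 →L[ℝ] E3), Adm A ∧ Inner t A ∧
        Near (Set.range x) c R t A (1 / 40) :=
  PredicateAPI.coarseGrains_iff

end Summit.AtomisticToContinuum.Crystallization.Cruxes.CoarseGrains.Disproof

end
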